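import Summits.QuantumFields.BalabanUV.Beta.WilsonBackgroundWard22Trace

/-!
# The TRACED ROTATION TERM of the background-gauge Ward identity (bgW₂) of the Wilson plaquette jets, IN CLOSED FORM (letter level)

(bgW₂) file 7, after leaf-09's parts 1–6 (setting: header of `WilsonBackgroundWard22.lean`; `WilsonBackgroundWard22Trace.bgWard22_trace` p214537 =
the fluctuation-colour TRACE of (bgW₂): rotated-letter term gone, TWO groups left — the `B`-polar `(2,2)` group and the `W`-polar `(2,1)` «rotation»
group `Σ_a 4·Pol_W F₂₁(h_a, ad_λ h_a; B)`, `h_a = (c₁•t_a,…,c₄•t_a)`).  THIS FILE EVALUATES THE ROTATION GROUP.  §1 `bil21_plaq`: the W-polar form of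
the per-plaquette `(2,1)`-jet, ALL letters (an3's `WilsonVertex.two_smul_trace_P21` ×3).  §2 colour sums for a letter family `t : C → 𝔸` under two
DISPLAYED hypotheses — (Fz) `Σ_a t_a M t_a = α•M + (β·τM)•1` (Fierz) and (Cas) `Σ_a t_a t_a = γ•1` — and a scalar tracial `τ`; the symmetric-cubic
colour sum VANISHES.  §3 **`sum_bil21_rot`**: the traced rotation group `= (α − γ)·𝒬(c; l; B)`, `𝒬` EXPLICIT (spin part against the background curl
`Z = B₁+B₂−B₃−B₄` and the DIFFERENCES of the start-corner gauge letters; two transport parts), traceless gauge letters.  §4 **`bgWard22_trace_eval`**: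
the traced (bgW₂) is the EXPLICIT TWO-TERM LAW `Σ_a 4·Pol_B F₂₂(h_a; B, W₀λ) = −2(α−γ)·𝒬` — NO remainder ((Cas) makes leaf-09's Casimir hypotheses
automatic).  §5 = the sequel `WilsonBackgroundWard22TraceRotGen` (Bałaban's letters `t = gen τ`, `ColourTrace.Complete`, the `ℂ`-trace: `α = 1, β = −N,
γ = 1 − N²`, so the coefficient is `α − γ = N²` — the lineage's toy finding (C), journal l.9794: «∝ N², no (N²−1) part, R ≡ 0»).  NOT HERE: the stencil∕`ℤ^{d+1}` transcription (leaf-10's W2TOY lane), the pin of `T`, the `rntr`∕`ℝ` reading.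
NOT IN PRINT; OUR BOOKKEEPING (cell `pub-balaban`, β sub-cell, D1 swarm seat `b2b-balaban-beta-d1-formalise-leaf-05` gen 4; CLAIM «D1-L4-W22-TRACED-
ROTATION»).  HONEST FRAMING (cell contract, verbatim): «discharging `BetaPertH` makes Bałaban's UV stability UNCONDITIONAL — a real constructive-QFT
result; it is NOT the continuum limit and NOT the Clay problem.»  HONEST DEPENDENCY (verbatim): «continuum YM on T⁴ ⇐ BetaPertH ∧ nine spine
estimates (0/9 proved); BetaPertH ⇐ (D1) ∧ (D4) ∧ CAP+tail; G-an2-4 gates asym, D1 and NE2/3/4.»  THIS FILE DISCHARGES NOTHING of the wall: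
[folklore] multilinear∕colour algebra for ONE letter law ((W-LET-S₂)₀, Wilson, background-gauge side) of ONE binder's W-side; 0 of 4 binders; not
D1, not BetaPertH, not continuum, not Clay.  ABSOLUTE RULE (cell, verbatim): «No internally-minted statement may enter as a cited fact. Every
hypothesis is either kernel-proved in this package or a verbatim quotation of a PUBLISHED theorem with page reference. The manuscript(s) under audit
are NOT citable for their own disputed steps — they are the thing under adjudication; programme-internal (2001/route/tribunal) claims are never
citable.»  Nothing cited; no `def`; kernel-proved from leaf-09's part 6 and an3's `WilsonVertex`∕`ColourTrace` BY NAME.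
-/

namespace Summit.QuantumFields.BalabanUV.Beta.WilsonBackgroundWard22TraceRot

open Literature.MathematicalPhysics.QuantumFieldTheory.Balaban1983to89.Beta.TransportVertices
open Literature.MathematicalPhysics.QuantumFieldTheory.Balaban1983to89.Beta.WilsonVertex
open Literature.MathematicalPhysics.QuantumFieldTheory.Balaban1983to89.Beta.WilsonVertex2
open Summit.QuantumFields.BalabanUV.Beta.WilsonBackgroundWard22Trace (bgWard22_trace)
open scoped BigOperators


section Polar -- §1 the W-polar form of the plaquette (2,1)-jet

variable (𝕜 : Type*) [RCLike 𝕜] {𝔸 : Type*} [NormedRing 𝔸] [NormedAlgebra 𝕜 𝔸]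
variable {V : Type*} [AddCommGroup V] [Module 𝕜 V]

/-- [folklore] §1 **THE W-POLAR FORM OF THE PLAQUETTE `(2,1)`-JET, ALL LETTERS.**  For every ring `𝔸`, every `𝕜`-linear tracial `τ`, fluctuation
letters `W`, `W′` and background letters `B` on the four bonds:
`2τP21(plaq (W+W′) B) − 2τP21(plaq W B) − 2τP21(plaq W′ B) = τ(H·H′·Z + H′·H·Z) + τ(Z·csP) + 2τ(H·tw(W′)) + 2τ(H′·tw(W))` —
symmetric cubic + spin (the polarised ordered-commutator sum `csP` of the signed letters `(W₁, W₂, −W₃, −W₄)`) + transport (`tw`, an3's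
`twist_plaq`), `H = W₁ + W₂ − W₃ − W₄`, `Z = B₁ + B₂ − B₃ − B₄` (an3's `WilsonVertex.two_smul_trace_P21` three times). [folklore] -/
theorem bil21_plaq (τ : 𝔸 →ₗ[𝕜] V) (hτ : ∀ a b : 𝔸, τ (a * b) = τ (b * a))
    (W₁ W₂ W₃ W₄ W'₁ W'₂ W'₃ W'₄ B₁ B₂ B₃ B₄ : 𝔸) :
    (2 : 𝕜) • τ (P21 𝕜 (plaq (W₁ + W'₁) (W₂ + W'₂) (W₃ + W'₃) (W₄ + W'₄) B₁ B₂ B₃ B₄))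
        - (2 : 𝕜) • τ (P21 𝕜 (plaq W₁ W₂ W₃ W₄ B₁ B₂ B₃ B₄)) - (2 : 𝕜) • τ (P21 𝕜 (plaq W'₁ W'₂ W'₃ W'₄ B₁ B₂ B₃ B₄)) =
      τ ((W₁ + W₂ - W₃ - W₄) * ((W'₁ + W'₂ - W'₃ - W'₄) * (B₁ + B₂ - B₃ - B₄))
          + (W'₁ + W'₂ - W'₃ - W'₄) * ((W₁ + W₂ - W₃ - W₄) * (B₁ + B₂ - B₃ - B₄)))
        + τ ((B₁ + B₂ - B₃ - B₄) *
            ((W₁ * W'₂ - W'₂ * W₁) + (W'₁ * W₂ - W₂ * W'₁) - (W₁ * W'₃ - W'₃ * W₁) - (W'₁ * W₃ - W₃ * W'₁)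
              - (W₁ * W'₄ - W'₄ * W₁) - (W'₁ * W₄ - W₄ * W'₁) - (W₂ * W'₃ - W'₃ * W₂) - (W'₂ * W₃ - W₃ * W'₂)
              - (W₂ * W'₄ - W'₄ * W₂) - (W'₂ * W₄ - W₄ * W'₂) + (W₃ * W'₄ - W'₄ * W₃) + (W'₃ * W₄ - W₄ * W'₃)))
        + (2 : 𝕜) • τ ((W₁ + W₂ - W₃ - W₄) *
            ((B₁ * W'₂ - W'₂ * B₁) - ((B₁ + B₂ - B₃) * W'₃ - W'₃ * (B₁ + B₂ - B₃))
              - ((B₁ + B₂ - B₃ - B₄) * W'₄ - W'₄ * (B₁ + B₂ - B₃ - B₄))))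
        + (2 : 𝕜) • τ ((W'₁ + W'₂ - W'₃ - W'₄) *
            ((B₁ * W₂ - W₂ * B₁) - ((B₁ + B₂ - B₃) * W₃ - W₃ * (B₁ + B₂ - B₃))
              - ((B₁ + B₂ - B₃ - B₄) * W₄ - W₄ * (B₁ + B₂ - B₃ - B₄)))) := by
  rw [two_smul_trace_P21 𝕜 τ hτ, two_smul_trace_P21 𝕜 τ hτ, two_smul_trace_P21 𝕜 τ hτ]
  simp only [wpart_plaq, bpart_plaq, sum_four_signed, twist_plaq]
  -- atoms
  set H := W₁ + W₂ - W₃ - W₄ with hH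
  set H' := W'₁ + W'₂ - W'₃ - W'₄ with hH'
  set Z := B₁ + B₂ - B₃ - B₄ with hZ
  set T := B₁ * W₂ - W₂ * B₁ - ((B₁ + B₂ - B₃) * W₃ - W₃ * (B₁ + B₂ - B₃)) - (Z * W₄ - W₄ * Z) with hT
  set T' := B₁ * W'₂ - W'₂ * B₁ - ((B₁ + B₂ - B₃) * W'₃ - W'₃ * (B₁ + B₂ - B₃)) - (Z * W'₄ - W'₄ * Z) with hT'
  set CS := commSum [W₁, W₂, -W₃, -W₄] with hCS
  set CS' := commSum [W'₁, W'₂, -W'₃, -W'₄] with hCS'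
  set P := (W₁ * W'₂ - W'₂ * W₁) + (W'₁ * W₂ - W₂ * W'₁) - (W₁ * W'₃ - W'₃ * W₁) - (W'₁ * W₃ - W₃ * W'₁)
      - (W₁ * W'₄ - W'₄ * W₁) - (W'₁ * W₄ - W₄ * W'₁) - (W₂ * W'₃ - W'₃ * W₂) - (W'₂ * W₃ - W₃ * W'₂)
      - (W₂ * W'₄ - W'₄ * W₂) - (W'₂ * W₄ - W₄ * W'₂) + (W₃ * W'₄ - W'₄ * W₃) + (W'₃ * W₄ - W₄ * W'₃) with hP
  -- the three structural polarisations (ring identities)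
  have e1 : W₁ + W'₁ + (W₂ + W'₂) - (W₃ + W'₃) - (W₄ + W'₄) = H + H' := by rw [hH, hH']; abel
  have c1 : (H + H') * ((H + H') * Z) = H * (H * Z) + H' * (H' * Z) + (H * (H' * Z) + H' * (H * Z)) := by noncomm_ring
  have c2 : commSum [W₁ + W'₁, W₂ + W'₂, -(W₃ + W'₃), -(W₄ + W'₄)] = CS + CS' + P := by
    rw [hCS, hCS', hP, commSum_four, commSum_four, commSum_four]; noncomm_ring
  have c3 : B₁ * (W₂ + W'₂) - (W₂ + W'₂) * B₁ - ((B₁ + B₂ - B₃) * (W₃ + W'₃) - (W₃ + W'₃) * (B₁ + B₂ - B₃))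
      - (Z * (W₄ + W'₄) - (W₄ + W'₄) * Z) = T + T' := by rw [hT, hT']; noncomm_ring
  rw [e1, c1, c2, c3]
  simp only [mul_add, add_mul, map_add, smul_add, two_smul]
  abel

end Polar

section ColourSums -- §2 colour sums under (Fz) and (Cas)

variable {𝕜 : Type*} [RCLike 𝕜] {𝔸 : Type*} [NormedRing 𝔸] [NormedAlgebra 𝕜 𝔸]
variable (τ : 𝔸 →ₗ[𝕜] 𝕜) {C : Type*} [Fintype C] (t : C → 𝔸) {α β γ : 𝕜}

/-- [folklore] (H1) `Σ_a τ(t_a X t_a Y) = α·τ(XY) + β·τ(X)·τ(Y)` from the Fierz∕sandwich hypothesis. -/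
theorem sum_trace_sandwich_mul (hFz : ∀ M : 𝔸, ∑ a, t a * M * t a = α • M + (β * τ M) • (1 : 𝔸)) (X Y : 𝔸) :
    ∑ a, τ (t a * X * t a * Y) = α * τ (X * Y) + β * τ X * τ Y := by
  have h : ∑ a, t a * X * t a * Y = (∑ a, t a * X * t a) * Y := by rw [Finset.sum_mul]
  rw [← map_sum, h, hFz, add_mul, smul_mul_assoc, smul_mul_assoc, one_mul, map_add, map_smul, map_smul, smul_eq_mul, smul_eq_mul]

/-- [folklore] (H2) `Σ_a τ(t_a t_a X) = γ·τ(X)` from the Casimir hypothesis. -/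
theorem sum_trace_sq_mul (hCas : ∑ a, t a * t a = γ • (1 : 𝔸)) (X : 𝔸) : ∑ a, τ (t a * t a * X) = γ * τ X := by
  have h : ∑ a, t a * t a * X = (∑ a, t a * t a) * X := by rw [Finset.sum_mul]
  rw [← map_sum, h, hCas, smul_mul_assoc, one_mul, map_smul, smul_eq_mul]

/-- [folklore] (H2') `Σ_a τ(t_a X t_a) = γ·τ(X)` (cyclicity + Casimir). -/
theorem sum_trace_sandwich (hτ : ∀ a b : 𝔸, τ (a * b) = τ (b * a)) (hCas : ∑ a, t a * t a = γ • (1 : 𝔸)) (X : 𝔸) :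
    ∑ a, τ (t a * X * t a) = γ * τ X := by
  have e : ∀ a, τ (t a * X * t a) = τ (t a * t a * X) := fun a => by rw [hτ (t a * X) (t a), ← mul_assoc]
  simp only [e]
  exact sum_trace_sq_mul τ t hCas X

/-- [folklore] (H3) `Σ_a [t_a, [l, t_a]] = 2(α − γ)•l + (2β·τ l)•1` (algebra level). -/
theorem sum_comm_comm (hFz : ∀ M : 𝔸, ∑ a, t a * M * t a = α • M + (β * τ M) • (1 : 𝔸))
    (hCas : ∑ a, t a * t a = γ • (1 : 𝔸)) (l : 𝔸) :
    ∑ a, (t a * (l * t a - t a * l) - (l * t a - t a * l) * t a) = (2 * (α - γ)) • l + (2 * β * τ l) • (1 : 𝔸) := by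
  have e : ∀ a, t a * (l * t a - t a * l) - (l * t a - t a * l) * t a = (2 : 𝕜) • (t a * l * t a) - (t a * t a * l + l * (t a * t a)) :=
    fun a => by rw [two_smul]; noncomm_ring
  simp only [e, Finset.sum_sub_distrib, Finset.sum_add_distrib, ← Finset.smul_sum, ← Finset.sum_mul, ← Finset.mul_sum, hFz, hCas,
    smul_mul_assoc, mul_smul_comm, one_mul, mul_one]
  module

/-- [folklore] (H4) `Σ_a τ(t_a·[X, [l, t_a]]) = 2(γ − α)·τ(X l) − 2β·τ(l)·τ(X)`. -/
theorem sum_trace_mul_comm_comm (hτ : ∀ a b : 𝔸, τ (a * b) = τ (b * a))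
    (hFz : ∀ M : 𝔸, ∑ a, t a * M * t a = α • M + (β * τ M) • (1 : 𝔸)) (hCas : ∑ a, t a * t a = γ • (1 : 𝔸)) (X l : 𝔸) :
    ∑ a, τ (t a * (X * (l * t a - t a * l) - (l * t a - t a * l) * X)) = 2 * (γ - α) * τ (X * l) - 2 * β * τ l * τ X := by
  have e : ∀ a, τ (t a * (X * (l * t a - t a * l) - (l * t a - t a * l) * X)) =
      τ (t a * (X * l) * t a) - τ (t a * X * t a * l) - τ (t a * l * t a * X) + τ (t a * t a * (l * X)) := fun a => by
    rw [show t a * (X * (l * t a - t a * l) - (l * t a - t a * l) * X) =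
      t a * (X * l) * t a - t a * X * t a * l - t a * l * t a * X + t a * t a * (l * X) by noncomm_ring]
    simp only [map_add, map_sub]
  simp only [e, Finset.sum_add_distrib, Finset.sum_sub_distrib, sum_trace_sandwich τ t hτ hCas, sum_trace_sandwich_mul τ t hFz,
    sum_trace_sq_mul τ t hCas, hτ l X]
  ring

/-- [folklore] (H5) `Σ_a τ([Λ, t_a]·[Γ, t_a]) = 2(α − γ)·τ(ΛΓ) + 2β·τ(Λ)·τ(Γ)`. -/
theorem sum_trace_comm_mul_comm (hτ : ∀ a b : 𝔸, τ (a * b) = τ (b * a))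
    (hFz : ∀ M : 𝔸, ∑ a, t a * M * t a = α • M + (β * τ M) • (1 : 𝔸)) (hCas : ∑ a, t a * t a = γ • (1 : 𝔸)) (Λ Γ : 𝔸) :
    ∑ a, τ ((Λ * t a - t a * Λ) * (Γ * t a - t a * Γ)) = 2 * (α - γ) * τ (Λ * Γ) + 2 * β * τ Λ * τ Γ := by
  have e : ∀ a, τ ((Λ * t a - t a * Λ) * (Γ * t a - t a * Γ)) =
      τ (t a * Γ * t a * Λ) - τ (t a * t a * (Γ * Λ)) - τ (t a * t a * (Λ * Γ)) + τ (t a * Λ * t a * Γ) := fun a => by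
    rw [show (Λ * t a - t a * Λ) * (Γ * t a - t a * Γ) =
      Λ * (t a * Γ * t a) - Λ * (t a * t a * Γ) - t a * Λ * Γ * t a + t a * Λ * t a * Γ by noncomm_ring]
    have r1 : τ (Λ * (t a * Γ * t a)) = τ (t a * Γ * t a * Λ) := hτ _ _
    have r2 : τ (Λ * (t a * t a * Γ)) = τ (t a * t a * (Γ * Λ)) := by rw [hτ, mul_assoc]
    have r3 : τ (t a * Λ * Γ * t a) = τ (t a * t a * (Λ * Γ)) := by
      rw [hτ (t a * Λ * Γ) (t a)]; congr 1; noncomm_ring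
    simp only [map_add, map_sub, r1, r2, r3]
  simp only [e, Finset.sum_add_distrib, Finset.sum_sub_distrib, sum_trace_sandwich_mul τ t hFz, sum_trace_sq_mul τ t hCas, hτ Γ Λ]
  ring

/-- [folklore] (H6) the symmetric-cubic colour sum vanishes: `Σ_a (s•t_a·[Λ,t_a] + [Λ,t_a]·s•t_a)·Z` has zero `τ` — indeed it IS zero. -/
theorem sum_symmCubic_eq_zero (hCas : ∑ a, t a * t a = γ • (1 : 𝔸)) (s : 𝕜) (Λ Z : 𝔸) :
    ∑ a, (s • t a * ((Λ * t a - t a * Λ) * Z) + (Λ * t a - t a * Λ) * (s • t a * Z)) = 0 := by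
  have e : ∀ a, s • t a * ((Λ * t a - t a * Λ) * Z) + (Λ * t a - t a * Λ) * (s • t a * Z) =
      s • ((Λ * (t a * t a) - t a * t a * Λ) * Z) := fun a => by
    rw [smul_mul_assoc, smul_mul_assoc, mul_smul_comm, ← smul_add]
    congr 1
    noncomm_ring
  rw [Finset.sum_congr rfl fun a _ => e a, ← Finset.smul_sum, ← Finset.sum_mul, Finset.sum_sub_distrib, ← Finset.mul_sum,
    ← Finset.sum_mul, hCas, mul_smul_comm, smul_mul_assoc, mul_one, one_mul, sub_self, zero_mul, smul_zero]

end ColourSums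

section Main -- §3–§4 the traced rotation term; the traced (bgW₂) as a two-term law

variable (𝕜 : Type*) [RCLike 𝕜] {𝔸 : Type*} [NormedRing 𝔸] [NormedAlgebra 𝕜 𝔸]
variable {C : Type*} [Fintype C]

/-- [folklore] §3 **THE TRACED ROTATION TERM OF (bgW₂) IN CLOSED FORM.**  Letter family `t : C → 𝔸` with the Fierz∕sandwich identity
(Fz) `Σ_a t_a M t_a = α•M + (β·τ M)•1` and the Casimir identity (Cas) `Σ_a t_a t_a = γ•1`, scalar-valued tracial `τ`, TRACELESS gauge
letters `l₁, l₂, l₄` (at the start corners `x₁, x₂, x₄` of the bonds `b₁, b₂ ∕ b₃ ∕ b₄`), bond pattern `c₁ … c₄` of the one-colour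
fluctuation `h_a = (c₁•t_a, …, c₄•t_a)`, corner rotation `ad_λ h_a = ([l₁,h₁], [l₂,h₂], [l₄,h₃], [l₁,h₄])`, ALL background letters:
`Σ_a (2τP21(plaq (h_a + ad_λ h_a) B) − 2τP21(plaq h_a B) − 2τP21(plaq (ad_λ h_a) B)) = (α − γ)·𝒬(c; l; B)` with `𝒬` the explicit
polynomial below (`Z = B₁ + B₂ − B₃ − B₄` the plaquette curl of the background; spin part `2·Σ_{i<j} ±c_ic_j τ(Z(l̂_j − l̂_i))`, transport
parts `−4(c₁+c₂−c₃−c₄)(c₂τ(B₁l₂) − c₃τ((B₁+B₂−B₃)l₄) − c₄τ(Zl₁))` and `+4τ(ΛΓ)`, `Λ = c₁•l₁ + c₂•l₂ − c₃•l₄ − c₄•l₁`,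
`Γ = c₂•B₁ − c₃•(B₁+B₂−B₃) − c₄•Z`); the symmetric-cubic part contributes NOTHING (§2 (H6)). [folklore] -/
theorem sum_bil21_rot (τ : 𝔸 →ₗ[𝕜] 𝕜) (hτ : ∀ a b : 𝔸, τ (a * b) = τ (b * a)) (t : C → 𝔸) {α β γ : 𝕜}
    (hFz : ∀ M : 𝔸, ∑ a, t a * M * t a = α • M + (β * τ M) • (1 : 𝔸)) (hCas : ∑ a, t a * t a = γ • (1 : 𝔸))
    (l₁ l₂ l₄ : 𝔸) (hl₁ : τ l₁ = 0) (hl₂ : τ l₂ = 0) (hl₄ : τ l₄ = 0) (c₁ c₂ c₃ c₄ : 𝕜) (B₁ B₂ B₃ B₄ : 𝔸) :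
    (∑ a, ((2 : 𝕜) • τ (P21 𝕜 (plaq (c₁ • t a + (l₁ * (c₁ • t a) - (c₁ • t a) * l₁)) (c₂ • t a + (l₂ * (c₂ • t a) - (c₂ • t a) * l₂))
            (c₃ • t a + (l₄ * (c₃ • t a) - (c₃ • t a) * l₄)) (c₄ • t a + (l₁ * (c₄ • t a) - (c₄ • t a) * l₁)) B₁ B₂ B₃ B₄))
        - (2 : 𝕜) • τ (P21 𝕜 (plaq (c₁ • t a) (c₂ • t a) (c₃ • t a) (c₄ • t a) B₁ B₂ B₃ B₄))
        - (2 : 𝕜) • τ (P21 𝕜 (plaq (l₁ * (c₁ • t a) - (c₁ • t a) * l₁) (l₂ * (c₂ • t a) - (c₂ • t a) * l₂)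
            (l₄ * (c₃ • t a) - (c₃ • t a) * l₄) (l₁ * (c₄ • t a) - (c₄ • t a) * l₁) B₁ B₂ B₃ B₄)))) =
      (α - γ) *
        (2 * (c₁ * c₂ * (τ ((B₁ + B₂ - B₃ - B₄) * l₂) - τ ((B₁ + B₂ - B₃ - B₄) * l₁))
              - c₁ * c₃ * (τ ((B₁ + B₂ - B₃ - B₄) * l₄) - τ ((B₁ + B₂ - B₃ - B₄) * l₁))
              - c₂ * c₃ * (τ ((B₁ + B₂ - B₃ - B₄) * l₄) - τ ((B₁ + B₂ - B₃ - B₄) * l₂))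
              - c₂ * c₄ * (τ ((B₁ + B₂ - B₃ - B₄) * l₁) - τ ((B₁ + B₂ - B₃ - B₄) * l₂))
              + c₃ * c₄ * (τ ((B₁ + B₂ - B₃ - B₄) * l₁) - τ ((B₁ + B₂ - B₃ - B₄) * l₄)))
          - 4 * (c₁ + c₂ - c₃ - c₄) *
            (c₂ * τ (B₁ * l₂) - c₃ * τ ((B₁ + B₂ - B₃) * l₄) - c₄ * τ ((B₁ + B₂ - B₃ - B₄) * l₁))
          + 4 * τ ((c₁ • l₁ + c₂ • l₂ - c₃ • l₄ - c₄ • l₁) *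
              (c₂ • B₁ - c₃ • (B₁ + B₂ - B₃) - c₄ • (B₁ + B₂ - B₃ - B₄)))) := by
  -- per colour: the polar form, reorganised into the input shapes of §2 (pure algebra + linearity of τ; no cyclicity)
  have canon : ∀ a : C,
      (2 : 𝕜) • τ (P21 𝕜 (plaq (c₁ • t a + (l₁ * (c₁ • t a) - (c₁ • t a) * l₁)) (c₂ • t a + (l₂ * (c₂ • t a) - (c₂ • t a) * l₂))
            (c₃ • t a + (l₄ * (c₃ • t a) - (c₃ • t a) * l₄)) (c₄ • t a + (l₁ * (c₄ • t a) - (c₄ • t a) * l₁)) B₁ B₂ B₃ B₄))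
        - (2 : 𝕜) • τ (P21 𝕜 (plaq (c₁ • t a) (c₂ • t a) (c₃ • t a) (c₄ • t a) B₁ B₂ B₃ B₄))
        - (2 : 𝕜) • τ (P21 𝕜 (plaq (l₁ * (c₁ • t a) - (c₁ • t a) * l₁) (l₂ * (c₂ • t a) - (c₂ • t a) * l₂)
            (l₄ * (c₃ • t a) - (c₃ • t a) * l₄) (l₁ * (c₄ • t a) - (c₄ • t a) * l₁) B₁ B₂ B₃ B₄)) =
      τ ((c₁ + c₂ - c₃ - c₄) • t a * (((c₁ • l₁ + c₂ • l₂ - c₃ • l₄ - c₄ • l₁) * t a - t a * (c₁ • l₁ + c₂ • l₂ - c₃ • l₄ - c₄ • l₁))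
            * (B₁ + B₂ - B₃ - B₄))
          + ((c₁ • l₁ + c₂ • l₂ - c₃ • l₄ - c₄ • l₁) * t a - t a * (c₁ • l₁ + c₂ • l₂ - c₃ • l₄ - c₄ • l₁))
            * ((c₁ + c₂ - c₃ - c₄) • t a * (B₁ + B₂ - B₃ - B₄)))
        + (c₁ * c₂ * (τ ((B₁ + B₂ - B₃ - B₄) * (t a * (l₂ * t a - t a * l₂) - (l₂ * t a - t a * l₂) * t a))
              - τ ((B₁ + B₂ - B₃ - B₄) * (t a * (l₁ * t a - t a * l₁) - (l₁ * t a - t a * l₁) * t a)))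
            - c₁ * c₃ * (τ ((B₁ + B₂ - B₃ - B₄) * (t a * (l₄ * t a - t a * l₄) - (l₄ * t a - t a * l₄) * t a))
              - τ ((B₁ + B₂ - B₃ - B₄) * (t a * (l₁ * t a - t a * l₁) - (l₁ * t a - t a * l₁) * t a)))
            - c₂ * c₃ * (τ ((B₁ + B₂ - B₃ - B₄) * (t a * (l₄ * t a - t a * l₄) - (l₄ * t a - t a * l₄) * t a))
              - τ ((B₁ + B₂ - B₃ - B₄) * (t a * (l₂ * t a - t a * l₂) - (l₂ * t a - t a * l₂) * t a)))
            - c₂ * c₄ * (τ ((B₁ + B₂ - B₃ - B₄) * (t a * (l₁ * t a - t a * l₁) - (l₁ * t a - t a * l₁) * t a))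
              - τ ((B₁ + B₂ - B₃ - B₄) * (t a * (l₂ * t a - t a * l₂) - (l₂ * t a - t a * l₂) * t a)))
            + c₃ * c₄ * (τ ((B₁ + B₂ - B₃ - B₄) * (t a * (l₁ * t a - t a * l₁) - (l₁ * t a - t a * l₁) * t a))
              - τ ((B₁ + B₂ - B₃ - B₄) * (t a * (l₄ * t a - t a * l₄) - (l₄ * t a - t a * l₄) * t a))))
        + 2 * ((c₁ + c₂ - c₃ - c₄) *
            (c₂ * τ (t a * (B₁ * (l₂ * t a - t a * l₂) - (l₂ * t a - t a * l₂) * B₁))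
              - c₃ * τ (t a * ((B₁ + B₂ - B₃) * (l₄ * t a - t a * l₄) - (l₄ * t a - t a * l₄) * (B₁ + B₂ - B₃)))
              - c₄ * τ (t a * ((B₁ + B₂ - B₃ - B₄) * (l₁ * t a - t a * l₁) - (l₁ * t a - t a * l₁) * (B₁ + B₂ - B₃ - B₄)))))
        + 2 * τ (((c₁ • l₁ + c₂ • l₂ - c₃ • l₄ - c₄ • l₁) * t a - t a * (c₁ • l₁ + c₂ • l₂ - c₃ • l₄ - c₄ • l₁))
            * ((c₂ • B₁ - c₃ • (B₁ + B₂ - B₃) - c₄ • (B₁ + B₂ - B₃ - B₄)) * t a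
              - t a * (c₂ • B₁ - c₃ • (B₁ + B₂ - B₃) - c₄ • (B₁ + B₂ - B₃ - B₄)))) := by
    intro a
    rw [bil21_plaq 𝕜 τ hτ]
    -- the four structural pieces, per colour (pure algebra)
    have hH : c₁ • t a + c₂ • t a - c₃ • t a - c₄ • t a = (c₁ + c₂ - c₃ - c₄) • t a := by module
    have hH' : l₁ * (c₁ • t a) - c₁ • t a * l₁ + (l₂ * (c₂ • t a) - c₂ • t a * l₂) - (l₄ * (c₃ • t a) - c₃ • t a * l₄)
        - (l₁ * (c₄ • t a) - c₄ • t a * l₁) =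
        (c₁ • l₁ + c₂ • l₂ - c₃ • l₄ - c₄ • l₁) * t a - t a * (c₁ • l₁ + c₂ • l₂ - c₃ • l₄ - c₄ • l₁) := by
      simp only [smul_mul_assoc, mul_smul_comm, add_mul, sub_mul, mul_add, mul_sub]
      module
    have hT : B₁ * (c₂ • t a) - c₂ • t a * B₁ - ((B₁ + B₂ - B₃) * (c₃ • t a) - c₃ • t a * (B₁ + B₂ - B₃))
        - ((B₁ + B₂ - B₃ - B₄) * (c₄ • t a) - c₄ • t a * (B₁ + B₂ - B₃ - B₄)) =
        (c₂ • B₁ - c₃ • (B₁ + B₂ - B₃) - c₄ • (B₁ + B₂ - B₃ - B₄)) * t a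
          - t a * (c₂ • B₁ - c₃ • (B₁ + B₂ - B₃) - c₄ • (B₁ + B₂ - B₃ - B₄)) := by
      set Z := B₁ + B₂ - B₃ - B₄
      set Y := B₁ + B₂ - B₃
      simp only [smul_mul_assoc, mul_smul_comm, sub_mul, mul_sub]
      module
    have hT' : B₁ * (l₂ * (c₂ • t a) - c₂ • t a * l₂) - (l₂ * (c₂ • t a) - c₂ • t a * l₂) * B₁
        - ((B₁ + B₂ - B₃) * (l₄ * (c₃ • t a) - c₃ • t a * l₄) - (l₄ * (c₃ • t a) - c₃ • t a * l₄) * (B₁ + B₂ - B₃))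
        - ((B₁ + B₂ - B₃ - B₄) * (l₁ * (c₄ • t a) - c₄ • t a * l₁) - (l₁ * (c₄ • t a) - c₄ • t a * l₁) * (B₁ + B₂ - B₃ - B₄)) =
        c₂ • (B₁ * (l₂ * t a - t a * l₂) - (l₂ * t a - t a * l₂) * B₁)
          - c₃ • ((B₁ + B₂ - B₃) * (l₄ * t a - t a * l₄) - (l₄ * t a - t a * l₄) * (B₁ + B₂ - B₃))
          - c₄ • ((B₁ + B₂ - B₃ - B₄) * (l₁ * t a - t a * l₁) - (l₁ * t a - t a * l₁) * (B₁ + B₂ - B₃ - B₄)) := by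
      set Z := B₁ + B₂ - B₃ - B₄
      set Y := B₁ + B₂ - B₃
      simp only [smul_mul_assoc, mul_smul_comm, sub_mul, mul_sub, smul_sub]
    have hP : c₁ • t a * (l₂ * (c₂ • t a) - c₂ • t a * l₂) - (l₂ * (c₂ • t a) - c₂ • t a * l₂) * (c₁ • t a)
          + ((l₁ * (c₁ • t a) - c₁ • t a * l₁) * (c₂ • t a) - c₂ • t a * (l₁ * (c₁ • t a) - c₁ • t a * l₁))
          - (c₁ • t a * (l₄ * (c₃ • t a) - c₃ • t a * l₄) - (l₄ * (c₃ • t a) - c₃ • t a * l₄) * (c₁ • t a))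
          - ((l₁ * (c₁ • t a) - c₁ • t a * l₁) * (c₃ • t a) - c₃ • t a * (l₁ * (c₁ • t a) - c₁ • t a * l₁))
          - (c₁ • t a * (l₁ * (c₄ • t a) - c₄ • t a * l₁) - (l₁ * (c₄ • t a) - c₄ • t a * l₁) * (c₁ • t a))
          - ((l₁ * (c₁ • t a) - c₁ • t a * l₁) * (c₄ • t a) - c₄ • t a * (l₁ * (c₁ • t a) - c₁ • t a * l₁))
          - (c₂ • t a * (l₄ * (c₃ • t a) - c₃ • t a * l₄) - (l₄ * (c₃ • t a) - c₃ • t a * l₄) * (c₂ • t a))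
          - ((l₂ * (c₂ • t a) - c₂ • t a * l₂) * (c₃ • t a) - c₃ • t a * (l₂ * (c₂ • t a) - c₂ • t a * l₂))
          - (c₂ • t a * (l₁ * (c₄ • t a) - c₄ • t a * l₁) - (l₁ * (c₄ • t a) - c₄ • t a * l₁) * (c₂ • t a))
          - ((l₂ * (c₂ • t a) - c₂ • t a * l₂) * (c₄ • t a) - c₄ • t a * (l₂ * (c₂ • t a) - c₂ • t a * l₂))
          + (c₃ • t a * (l₁ * (c₄ • t a) - c₄ • t a * l₁) - (l₁ * (c₄ • t a) - c₄ • t a * l₁) * (c₃ • t a))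
          + ((l₄ * (c₃ • t a) - c₃ • t a * l₄) * (c₄ • t a) - c₄ • t a * (l₄ * (c₃ • t a) - c₃ • t a * l₄)) =
        (c₁ * c₂) • ((t a * (l₂ * t a - t a * l₂) - (l₂ * t a - t a * l₂) * t a) - (t a * (l₁ * t a - t a * l₁) - (l₁ * t a - t a * l₁) * t a))
          - (c₁ * c₃) • ((t a * (l₄ * t a - t a * l₄) - (l₄ * t a - t a * l₄) * t a) - (t a * (l₁ * t a - t a * l₁) - (l₁ * t a - t a * l₁) * t a))
          - (c₂ * c₃) • ((t a * (l₄ * t a - t a * l₄) - (l₄ * t a - t a * l₄) * t a) - (t a * (l₂ * t a - t a * l₂) - (l₂ * t a - t a * l₂) * t a))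
          - (c₂ * c₄) • ((t a * (l₁ * t a - t a * l₁) - (l₁ * t a - t a * l₁) * t a) - (t a * (l₂ * t a - t a * l₂) - (l₂ * t a - t a * l₂) * t a))
          + (c₃ * c₄) • ((t a * (l₁ * t a - t a * l₁) - (l₁ * t a - t a * l₁) * t a) - (t a * (l₄ * t a - t a * l₄) - (l₄ * t a - t a * l₄) * t a)) := by
      simp only [smul_mul_assoc, mul_smul_comm, sub_mul, mul_sub, smul_sub, smul_smul, mul_assoc]
      module
    rw [hH, hH', hT, hT', hP]
    -- light linear bookkeeping (atoms kept: the curl `Z`, the partial sum `Y`, `Λ`, `Γ`)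
    set Z := B₁ + B₂ - B₃ - B₄
    set Y := B₁ + B₂ - B₃
    set Λ := c₁ • l₁ + c₂ • l₂ - c₃ • l₄ - c₄ • l₁
    set Γ := c₂ • B₁ - c₃ • Y - c₄ • Z
    simp only [mul_sub, mul_add, smul_mul_assoc, mul_smul_comm, map_add, map_sub, map_smul, smul_eq_mul]
    ring
  rw [Finset.sum_congr rfl fun a _ => canon a]
  -- the colour sums of §2
  have hA := congrArg τ (sum_symmCubic_eq_zero t hCas (c₁ + c₂ - c₃ - c₄) (c₁ • l₁ + c₂ • l₂ - c₃ • l₄ - c₄ • l₁) (B₁ + B₂ - B₃ - B₄))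
  rw [map_sum, map_zero] at hA
  have hK : ∀ l : 𝔸, ∑ a, τ ((B₁ + B₂ - B₃ - B₄) * (t a * (l * t a - t a * l) - (l * t a - t a * l) * t a)) =
      2 * (α - γ) * τ ((B₁ + B₂ - B₃ - B₄) * l) + 2 * β * τ l * τ (B₁ + B₂ - B₃ - B₄) := fun l => by
    rw [← map_sum, ← Finset.mul_sum, sum_comm_comm τ t hFz hCas l, mul_add, mul_smul_comm, mul_smul_comm, mul_one, map_add, map_smul,
      map_smul, smul_eq_mul, smul_eq_mul]
  have hM := sum_trace_mul_comm_comm τ t hτ hFz hCas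
  have hCC := sum_trace_comm_mul_comm τ t hτ hFz hCas
  have hΛ : τ (c₁ • l₁ + c₂ • l₂ - c₃ • l₄ - c₄ • l₁) = 0 := by
    simp only [map_add, map_sub, map_smul, hl₁, hl₂, hl₄, smul_zero, add_zero, sub_zero]
  simp only [Finset.sum_add_distrib, Finset.sum_sub_distrib, ← Finset.mul_sum, hA, hK, hM, hCC, hl₁, hl₂, hl₄, hΛ]
  ring

/-- [folklore] §4 **THE TRACED (bgW₂) AS AN EXPLICIT TWO-TERM LAW.**  Plugging §3 into leaf-09's `WilsonBackgroundWard22Trace.bgWard22_trace` (its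
Casimir-commutation hypotheses are AUTOMATIC under (Cas): `Σ_a t_a t_a = γ•1` is central): for the one-colour fluctuation pattern `c`, summed over
the colour, the `B`-polar `(2,2)` term against the pure-gauge background `W₀λ = (l₁ − l₂, l₂ − l₃, l₄ − l₃, l₁ − l₄)` EQUALS minus twice the
closed-form rotation term: `Σ_a 4·Pol_B F₂₂(h_a; B, W₀λ) = −2(α − γ)·𝒬(c; l; B)` — NO remainder, and the only colour datum is `α − γ`
(`= N²` in Bałaban's letters, §5).  Traceless `l₁, l₂, l₄`; `l₃` and the background letters arbitrary. [folklore] -/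
theorem bgWard22_trace_eval (τ : 𝔸 →ₗ[𝕜] 𝕜) (hτ : ∀ a b : 𝔸, τ (a * b) = τ (b * a)) (t : C → 𝔸) {α β γ : 𝕜}
    (hFz : ∀ M : 𝔸, ∑ a, t a * M * t a = α • M + (β * τ M) • (1 : 𝔸)) (hCas : ∑ a, t a * t a = γ • (1 : 𝔸))
    (l₁ l₂ l₃ l₄ : 𝔸) (hl₁ : τ l₁ = 0) (hl₂ : τ l₂ = 0) (hl₄ : τ l₄ = 0) (c₁ c₂ c₃ c₄ : 𝕜) (B₁ B₂ B₃ B₄ : 𝔸) :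
    (∑ a, ((4 : 𝕜) • τ (P22 𝕜 (plaq (c₁ • t a) (c₂ • t a) (c₃ • t a) (c₄ • t a)
          (B₁ + (l₁ - l₂)) (B₂ + (l₂ - l₃)) (B₃ + (l₄ - l₃)) (B₄ + (l₁ - l₄))))
        - (4 : 𝕜) • τ (P22 𝕜 (plaq (c₁ • t a) (c₂ • t a) (c₃ • t a) (c₄ • t a) B₁ B₂ B₃ B₄))
        - (4 : 𝕜) • τ (P22 𝕜 (plaq (c₁ • t a) (c₂ • t a) (c₃ • t a) (c₄ • t a) (l₁ - l₂) (l₂ - l₃) (l₄ - l₃) (l₁ - l₄))))) =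
      -(2 * ((α - γ) *
        (2 * (c₁ * c₂ * (τ ((B₁ + B₂ - B₃ - B₄) * l₂) - τ ((B₁ + B₂ - B₃ - B₄) * l₁))
              - c₁ * c₃ * (τ ((B₁ + B₂ - B₃ - B₄) * l₄) - τ ((B₁ + B₂ - B₃ - B₄) * l₁))
              - c₂ * c₃ * (τ ((B₁ + B₂ - B₃ - B₄) * l₄) - τ ((B₁ + B₂ - B₃ - B₄) * l₂))
              - c₂ * c₄ * (τ ((B₁ + B₂ - B₃ - B₄) * l₁) - τ ((B₁ + B₂ - B₃ - B₄) * l₂))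
              + c₃ * c₄ * (τ ((B₁ + B₂ - B₃ - B₄) * l₁) - τ ((B₁ + B₂ - B₃ - B₄) * l₄)))
          - 4 * (c₁ + c₂ - c₃ - c₄) *
            (c₂ * τ (B₁ * l₂) - c₃ * τ ((B₁ + B₂ - B₃) * l₄) - c₄ * τ ((B₁ + B₂ - B₃ - B₄) * l₁))
          + 4 * τ ((c₁ • l₁ + c₂ • l₂ - c₃ • l₄ - c₄ • l₁) *
              (c₂ • B₁ - c₃ • (B₁ + B₂ - B₃) - c₄ • (B₁ + B₂ - B₃ - B₄)))))) := by
  -- the Casimir is central under (Cas)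
  have hc : ∀ l : 𝔸, (∑ a, t a * t a) * l = l * ∑ a, t a * t a := fun l => by
    rw [hCas, smul_mul_assoc, mul_smul_comm, one_mul, mul_one]
  have h := bgWard22_trace 𝕜 τ hτ t l₁ l₂ l₃ l₄ (hc l₁) (hc l₂) (hc l₃) (hc l₄) c₁ c₂ c₃ c₄ B₁ B₂ B₃ B₄
  rw [Finset.sum_add_distrib] at h
  have h2 : (∑ a, ((4 : 𝕜) • τ (P21 𝕜 (plaq (c₁ • t a + (l₁ * (c₁ • t a) - (c₁ • t a) * l₁)) (c₂ • t a + (l₂ * (c₂ • t a) - (c₂ • t a) * l₂))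
            (c₃ • t a + (l₄ * (c₃ • t a) - (c₃ • t a) * l₄)) (c₄ • t a + (l₁ * (c₄ • t a) - (c₄ • t a) * l₁)) B₁ B₂ B₃ B₄))
          - (4 : 𝕜) • τ (P21 𝕜 (plaq (c₁ • t a) (c₂ • t a) (c₃ • t a) (c₄ • t a) B₁ B₂ B₃ B₄))
          - (4 : 𝕜) • τ (P21 𝕜 (plaq (l₁ * (c₁ • t a) - (c₁ • t a) * l₁) (l₂ * (c₂ • t a) - (c₂ • t a) * l₂)
            (l₄ * (c₃ • t a) - (c₃ • t a) * l₄) (l₁ * (c₄ • t a) - (c₄ • t a) * l₁) B₁ B₂ B₃ B₄)))) =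
      2 * ∑ a, ((2 : 𝕜) • τ (P21 𝕜 (plaq (c₁ • t a + (l₁ * (c₁ • t a) - (c₁ • t a) * l₁)) (c₂ • t a + (l₂ * (c₂ • t a) - (c₂ • t a) * l₂))
            (c₃ • t a + (l₄ * (c₃ • t a) - (c₃ • t a) * l₄)) (c₄ • t a + (l₁ * (c₄ • t a) - (c₄ • t a) * l₁)) B₁ B₂ B₃ B₄))
          - (2 : 𝕜) • τ (P21 𝕜 (plaq (c₁ • t a) (c₂ • t a) (c₃ • t a) (c₄ • t a) B₁ B₂ B₃ B₄))
          - (2 : 𝕜) • τ (P21 𝕜 (plaq (l₁ * (c₁ • t a) - (c₁ • t a) * l₁) (l₂ * (c₂ • t a) - (c₂ • t a) * l₂)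
            (l₄ * (c₃ • t a) - (c₃ • t a) * l₄) (l₁ * (c₄ • t a) - (c₄ • t a) * l₁) B₁ B₂ B₃ B₄))) := by
    rw [Finset.mul_sum]
    refine Finset.sum_congr rfl fun a _ => ?_
    simp only [smul_eq_mul]
    ring
  rw [h2, sum_bil21_rot 𝕜 τ hτ t hFz hCas l₁ l₂ l₄ hl₁ hl₂ hl₄ c₁ c₂ c₃ c₄ B₁ B₂ B₃ B₄] at h
  linear_combination h

end Main


end Summit.QuantumFields.BalabanUV.Beta.WilsonBackgroundWard22TraceRot
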